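import Mathlib.GroupTheory.Index
import Literature.NumberTheory.GaloisRepresentations.LocalGlobalCohomologyDualityProofs
import HarnessLib

/-!
# T1 JET (cell `bsd-jet`), road K, file 1/3: finite-group duality for SUMS of local pairings —
# `#S^⊥ · #S = #B`, annihilators of products, and the counting identity
# `[L + F : F] · [L' + G^⊥ : G^⊥] = [G : F]` behind «the images are exact orthogonal complements»

HONEST FRAMING (programme file `BSD-LIT2PART-PROGRAMME-v1.md` §HONESTY, verbatim): «no tranche here
proves BSD; ARM L moves the LITERAL column of an r ≤ 1 census into the kernel-proved-modulo-named-print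
column; ARM P changes what «named print» is worth.» THEOREMS ONLY (seat `bsd-jet-pv-1`, session g3;
`--supports stmt-BirchSwinnertonDyer-14418`, helper): no definition, no named fact, no `sorry`;
PURE ALGEBRA (no Galois cohomology, no elliptic curve). Nothing is booked; 0 classes move.

## Why (road K of the cell = the KERNEL discharge of the reading binders `JET.JetchevDivisibilityCarrierNe`
## ∕ `…CarrierMult`, sheet `HOME/sheets/PV2-J6-KERNEL.md`)

The cell's abstract kernel form of Jetchev 2008 Thm. 6.3
(`JET.Section6.tamagawaExponent_le_mInfty_of_minimalCoreVertex`, `Theorems/Rank1ResidualJetSection6.lean`,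
p471669) consumes Poitou–Tate global duality for Selmer structures (Jetchev Thm. 5.1 = Howard 2004
Thm. 2.1.11 = Mazur–Rubin 2004 Thm. 2.3.4: «the images of `loc` and `loc^*` are exact orthogonal
complements») in COUNTING form — hypotheses `horth_q : #im locq · #im locq' = #Q'` and
`horth_ℓ : #im(sing ℓ) · #loc_λ(C') = p^m` (= Lemma 5.2 (iii) `a + a^* = m`). The tree's named fact
`poitouTate_selmerStructure_duality` (`Literature/NumberTheory/GaloisCohomology/PoitouTateSelmerStructures.lean`)
records the ELEMENT form only («Not included: the counting form of "orthogonal complements"»). File 3/3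
(`Theorems/Rank1ResidualJetGlobalDuality.lean`, with the Galois lemmas of file 2/3
`Theorems/Rank1ResidualJetGlobalDualityLocal.lean`) derives the counting form
`[H¹_𝓖 : H¹_𝓕] · [H¹_{𝓕^*} : H¹_{𝓖^*}] = ∏_{v ∈ S} [𝓖_v : 𝓕_v]` from the element form; this file is
its finite-group bookkeeping, kept separate (files ≤ 400 lines, one topic each).

## What is proved (elementary; Milne, *ADT*, I §0 (0.19) «the dual of a finite group is exact»)

* §1 `natCard_iInf_ker_mul_natCard` — **`#S^⊥ · #S = #B`** for a PERFECT pairing `b : A × B → ℤ/n`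
  of finite abelian groups killed by `n` (both adjoints injective) and every subgroup `S ≤ A`, with
  `S^⊥ = ⨅ s ∈ S, ker (b s) ≤ B` (the two-group twin of the tree's `natCard_iInf_ker_flip_mul_natCard`;
  counting with `#Hom(C, ℤ/n) = #C`, tree `Nat.card_addMonoidHom_zmod`).
* §2 sums of pairings `bS(x, y) = ∑_i b_i(x_i, y_i)` on finite products (stated for ANY `bS` satisfying
  that formula — no definition is introduced): values on tuples supported at one index, injectivity of
  both adjoints from that of the summands (`sum_pairing_injective`, `sum_pairing_flip_injective`),
  **the annihilator of a product of subgroups is the product of the annihilators** (`iInf_ker_pi_eq`),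
  and `#(Π_i F_i) = ∏_i #F_i` (`natCard_pi`).
* §3 `relIndex_mul_relIndex_eq_of_iInf_ker_sup` — **the counting identity**: for a perfect
  `bS : X × Y → ℤ/n`, subgroups `F ≤ G ≤ X`, `L ≤ X`, `L' ≤ Y` with `(L + F)^⊥ = L' + G^⊥`:
  `F.relIndex L · G^⊥.relIndex L' = F.relIndex G`, i.e. `[L + F : F] · [L' + G^⊥ : G^⊥] = [G : F]`
  (from `#(L+F)^⊥ · #(L+F) = #Y = #G^⊥ · #G`).

References (locators only; no cited FACT is declared): [cite: MilneADT2006, Ch. I §0 (0.19), Thm. 4.10]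
[cite: Howard2004HeegnerKolyvagin, Thm. 2.1.11 (arXiv:1202.6340 p. 6)] [cite: Jetchev2008, Thm. 5.1,
Lemma 5.2 (iii), proof of Thm. 6.3 (pp. 822–824)].

Design: no definitions; `Type*`-polymorphic; `Nat.card` and `AddSubgroup.relIndex` throughout (finite
indices need no global finiteness). Axioms: `propext`, `Classical.choice`, `Quot.sound`.
-/

set_option autoImplicit false

noncomputable section

open scoped Classical
open Function
open Literature.NumberTheory.GaloisRepresentations

namespace Summit.BirchSwinnertonDyer.Rank1Residual.JET.GlobalDuality

/-! ### §1 Finite-group duality with two groups: `#S^⊥ · #S = #B` -/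

section TwoGroups

/-- Membership in the (right) annihilator term `⨅ s ∈ S, (b s).ker ≤ B` of a subgroup `S ≤ A`
under a bi-additive pairing `b : A × B → Q`. -/
theorem mem_iInf_ker_iff {A B Q : Type*} [AddCommGroup A] [AddCommGroup B] [AddCommGroup Q]
    (b : A →+ B →+ Q) (S : AddSubgroup A) (y : B) :
    y ∈ (⨅ s ∈ S, (b s).ker : AddSubgroup B) ↔ ∀ s ∈ S, b s y = 0 := by
  simp only [AddSubgroup.mem_iInf, AddMonoidHom.mem_ker]

variable {A B : Type*} [AddCommGroup A] [AddCommGroup B] [Finite A] [Finite B] {n : ℕ} [NeZero n]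
  (b : A →+ B →+ ZMod n) (hA : ∀ x : A, n • x = 0) (hB : ∀ y : B, n • y = 0)
  (hl : Injective b) (hr : Injective b.flip)
include hA hB hl hr

/-- **`#S^⊥ · #S = #B`** for a perfect `ℤ/n`-valued pairing `b : A × B → ℤ/n` of finite abelian
groups killed by `n` (both adjoints injective) and any subgroup `S ≤ A`, `S^⊥ ≤ B` its annihilator:
`S^⊥ ↪ Hom(A/S, ℤ/n)`, `A ↪ Hom(B, ℤ/n)`, `B/S^⊥ ↪ Hom(S, ℤ/n)` and `#Hom(C, ℤ/n) = #C` (tree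
`Nat.card_addMonoidHom_zmod`). Milne, *ADT*, I §0 (0.19); the one-group version is the tree's
`natCard_iInf_ker_flip_mul_natCard`. [cite: MilneADT2006, Ch. I §0, Prop. 0.19] -/
theorem natCard_iInf_ker_mul_natCard (S : AddSubgroup A) :
    Nat.card (⨅ s ∈ S, (b s).ker : AddSubgroup B) * Nat.card S = Nat.card B := by
  apply le_antisymm
  · -- `S^⊥ ↪ Hom(A ⧸ S, ℤ/n)` and `A ↪ Hom(B, ℤ/n)`
    have hq : ∀ z : A ⧸ S, n • z = 0 := fun z => by
      induction z using QuotientAddGroup.induction_on with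
      | H y => rw [← QuotientAddGroup.mk_nsmul, hA, QuotientAddGroup.mk_zero]
    haveI := finite_addMonoidHom_zmod (A ⧸ S) n
    haveI := finite_addMonoidHom_zmod B n
    let φ : (⨅ s ∈ S, (b s).ker : AddSubgroup B) → (A ⧸ S →+ ZMod n) := fun y =>
      QuotientAddGroup.lift S (b.flip y) fun s hs =>
        (AddMonoidHom.mem_ker).mpr (((mem_iInf_ker_iff b S y).mp y.2) s hs)
    have hφ : Injective φ := by
      intro y y' h
      apply Subtype.ext
      apply hr
      refine AddMonoidHom.ext fun x => ?_
      have h' := DFunLike.congr_fun h (x : A ⧸ S)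
      rwa [QuotientAddGroup.lift_mk, QuotientAddGroup.lift_mk] at h'
    have hAB : Nat.card A ≤ Nat.card B :=
      (Nat.card_le_card_of_injective b hl).trans_eq (Nat.card_addMonoidHom_zmod hB)
    calc Nat.card (⨅ s ∈ S, (b s).ker : AddSubgroup B) * Nat.card S
        ≤ Nat.card (A ⧸ S →+ ZMod n) * Nat.card S :=
          Nat.mul_le_mul_right _ (Nat.card_le_card_of_injective φ hφ)
      _ = Nat.card (A ⧸ S) * Nat.card S := by rw [Nat.card_addMonoidHom_zmod hq]
      _ = Nat.card A := (AddSubgroup.card_eq_card_quotient_mul_card_addSubgroup S).symm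
      _ ≤ Nat.card B := hAB
  · -- `B ⧸ S^⊥ ↪ Hom(S, ℤ/n)` by restriction
    haveI := finite_addMonoidHom_zmod S n
    let r : B →+ (S →+ ZMod n) :=
      AddMonoidHom.mk' (fun y => (b.flip y).comp S.subtype) fun y y' => by
        ext s
        simp only [map_add, AddMonoidHom.coe_comp, comp_apply, AddMonoidHom.add_apply]
    have hrap : ∀ (y : B) (s : S), r y s = b s y := fun _ _ => rfl
    have hker : r.ker = ⨅ s ∈ S, (b s).ker := by
      ext y
      rw [AddMonoidHom.mem_ker, mem_iInf_ker_iff b]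
      constructor
      · intro h s hs
        rw [← hrap y ⟨s, hs⟩, h, AddMonoidHom.zero_apply]
      · intro h
        exact AddMonoidHom.ext fun s => (hrap y s).trans (h s s.2)
    have hS : ∀ s : S, n • s = 0 := fun s => Subtype.ext (by
      rw [AddSubgroupClass.coe_nsmul, hA]; rfl)
    calc Nat.card B = Nat.card (B ⧸ r.ker) * Nat.card r.ker :=
          AddSubgroup.card_eq_card_quotient_mul_card_addSubgroup r.ker
      _ ≤ Nat.card (S →+ ZMod n) * Nat.card r.ker :=
          Nat.mul_le_mul_right _
            (Nat.card_le_card_of_injective _ (QuotientAddGroup.kerLift_injective r))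
      _ = Nat.card S * Nat.card (⨅ s ∈ S, (b s).ker : AddSubgroup B) := by
          rw [Nat.card_addMonoidHom_zmod hS, hker]
      _ = Nat.card (⨅ s ∈ S, (b s).ker : AddSubgroup B) * Nat.card S := mul_comm _ _

end TwoGroups

/-! ### §2 Sums of pairings over a finite index set -/

section PiPairing

variable {ι : Type*} [Fintype ι] {A B : ι → Type*} [∀ i, AddCommGroup (A i)]
  [∀ i, AddCommGroup (B i)] {Q : Type*} [AddCommGroup Q]
  (b : ∀ i, A i →+ B i →+ Q) (bS : (∀ i, A i) →+ (∀ i, B i) →+ Q)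
  (hbS : ∀ x y, bS x y = ∑ i, b i (x i) (y i))
include hbS

/-- A sum pairing evaluated on a tuple supported at one index (left). -/
theorem sum_pairing_single_left (i : ι) (a : A i) (y : ∀ i, B i) :
    bS (Pi.single i a) y = b i a (y i) := by
  rw [hbS, Finset.sum_eq_single i]
  · rw [Pi.single_eq_same]
  · intro j _ hj
    rw [Pi.single_eq_of_ne hj, map_zero, AddMonoidHom.zero_apply]
  · exact fun h => absurd (Finset.mem_univ i) h

/-- A sum pairing evaluated on a tuple supported at one index (right). -/
theorem sum_pairing_single_right (x : ∀ i, A i) (i : ι) (c : B i) :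
    bS x (Pi.single i c) = b i (x i) c := by
  rw [hbS, Finset.sum_eq_single i]
  · rw [Pi.single_eq_same]
  · intro j _ hj
    rw [Pi.single_eq_of_ne hj, map_zero]
  · exact fun h => absurd (Finset.mem_univ i) h

/-- The left adjoint of a sum of pairings with injective left adjoints is injective. -/
theorem sum_pairing_injective (h : ∀ i, Injective (b i)) : Injective bS := by
  intro x x' hx
  funext i
  apply h i
  refine AddMonoidHom.ext fun c => ?_
  rw [← sum_pairing_single_right b bS hbS x i c, ← sum_pairing_single_right b bS hbS x' i c, hx]

/-- The right adjoint of a sum of pairings with injective right adjoints is injective. -/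
theorem sum_pairing_flip_injective (h : ∀ i, Injective (b i).flip) : Injective bS.flip := by
  intro y y' hy
  funext i
  apply h i
  refine AddMonoidHom.ext fun a => ?_
  rw [AddMonoidHom.flip_apply, AddMonoidHom.flip_apply, ← sum_pairing_single_left b bS hbS i a y,
    ← sum_pairing_single_left b bS hbS i a y']
  have := DFunLike.congr_fun hy (Pi.single i a)
  rwa [AddMonoidHom.flip_apply, AddMonoidHom.flip_apply] at this

/-- **The annihilator of a product of subgroups is the product of the annihilators** (under a sum
of pairings). -/
theorem iInf_ker_pi_eq (F : ∀ i, AddSubgroup (A i)) :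
    (⨅ s ∈ AddSubgroup.pi Set.univ F, (bS s).ker : AddSubgroup (∀ i, B i)) =
      AddSubgroup.pi Set.univ fun i => ⨅ a ∈ F i, (b i a).ker := by
  ext y
  simp only [AddSubgroup.mem_iInf, AddMonoidHom.mem_ker, AddSubgroup.mem_pi, Set.mem_univ,
    true_implies]
  constructor
  · intro h i a ha
    rw [← sum_pairing_single_left b bS hbS i a y]
    exact h _ fun j => by
      by_cases hj : j = i
      · subst hj; rw [Pi.single_eq_same]; exact ha
      · rw [Pi.single_eq_of_ne hj]; exact zero_mem _
  · intro h s hs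
    rw [hbS]
    exact Finset.sum_eq_zero fun i _ => h i (s i) (hs i)

omit hbS in
/-- The cardinality of a product of subgroups. -/
theorem natCard_pi (F : ∀ i, AddSubgroup (A i)) :
    Nat.card (AddSubgroup.pi Set.univ F) = ∏ i, Nat.card (F i) := by
  rw [← Nat.card_pi]
  refine Nat.card_congr
    { toFun := fun x i => ⟨x.1 i, x.2 i (Set.mem_univ i)⟩
      invFun := fun y => ⟨fun i => y i, fun i _ => (y i).2⟩
      left_inv := fun x => rfl
      right_inv := fun y => rfl }

end PiPairing

/-! ### §3 The counting identity behind «images are exact orthogonal complements» (pure algebra) -/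

section CountingAlgebra

variable {X Y : Type*} [AddCommGroup X] [AddCommGroup Y] [Finite X] [Finite Y] {n : ℕ} [NeZero n]
  (bS : X →+ Y →+ ZMod n) (hX : ∀ x : X, n • x = 0) (hY : ∀ y : Y, n • y = 0)
  (hl : Injective bS) (hr : Injective bS.flip)
include hX hY hl hr

/-- **The counting form of «exact orthogonal complements».** Finite abelian groups `X`, `Y` killed
by `n` with a perfect pairing `bS : X × Y → ℤ/n`; subgroups `F ≤ G ≤ X` («local conditions»),
`L ≤ G` («image of the global classes with conditions `G`») and `L' ≤ Y` («image of the dual global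
classes with conditions `F^*`»). If the annihilator of `L + F` is `L' + G^⊥` — i.e. the images of
`L` in `G/F` and of `L'` in `F^⊥/G^⊥` are exact annihilators of each other under the induced perfect
pairing `G/F × F^⊥/G^⊥ → ℤ/n` — then `[L + F : F] · [L' + G^⊥ : G^⊥] = [G : F]`, written with
`AddSubgroup.relIndex`: `F.relIndex L * G^⊥.relIndex L' = F.relIndex G`. This is the bookkeeping by
which Poitou–Tate duality for Selmer structures is USED as a product of cardinalities (Jetchev 2008,
proof of Thm. 6.3, «This allows us to apply global duality to conclude that Inv …»; Darmon–Diamond–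
Taylor Thm. 2.19; Mazur–Rubin 2004 Thm. 2.3.4). [cite: Jetchev2008, Thm. 5.1 and proof of Thm. 6.3 (pp. 822–824)]
[cite: MilneADT2006, Ch. I §0, Prop. 0.19] -/
theorem relIndex_mul_relIndex_eq_of_iInf_ker_sup (F G L : AddSubgroup X) (L' : AddSubgroup Y)
    (hFG : F ≤ G)
    (hann : (⨅ s ∈ L ⊔ F, (bS s).ker : AddSubgroup Y) = L' ⊔ ⨅ s ∈ G, (bS s).ker) :
    F.relIndex L * (⨅ s ∈ G, (bS s).ker : AddSubgroup Y).relIndex L' = F.relIndex G := by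
  set annG : AddSubgroup Y := ⨅ s ∈ G, (bS s).ker with hannG_def
  -- `#(L ⊔ F)^⊥ · #(L ⊔ F) = #Y` and `#G^⊥ · #G = #Y`
  have h1 := natCard_iInf_ker_mul_natCard bS hX hY hl hr (L ⊔ F)
  have h2 := natCard_iInf_ker_mul_natCard bS hX hY hl hr G
  rw [hann] at h1
  -- cardinalities of `L ⊔ F`, `L' ⊔ G^⊥`, `G` through relative indices
  have hI : Nat.card F * F.relIndex L = Nat.card (L ⊔ F : AddSubgroup X) := by
    have := AddSubgroup.relIndex_mul_relIndex ⊥ F (L ⊔ F) bot_le le_sup_right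
    rwa [AddSubgroup.relIndex_bot_left, AddSubgroup.relIndex_bot_left,
      AddSubgroup.relIndex_sup_right] at this
  have hJ : Nat.card annG * annG.relIndex L' = Nat.card (L' ⊔ annG : AddSubgroup Y) := by
    have := AddSubgroup.relIndex_mul_relIndex ⊥ annG (L' ⊔ annG) bot_le le_sup_right
    rwa [AddSubgroup.relIndex_bot_left, AddSubgroup.relIndex_bot_left,
      AddSubgroup.relIndex_sup_right] at this
  have hG : Nat.card F * F.relIndex G = Nat.card G := by
    have := AddSubgroup.relIndex_mul_relIndex ⊥ F G bot_le hFG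
    rwa [AddSubgroup.relIndex_bot_left, AddSubgroup.relIndex_bot_left] at this
  have key : Nat.card annG * Nat.card F * (F.relIndex L * annG.relIndex L') =
      Nat.card annG * Nat.card F * F.relIndex G := by
    calc Nat.card annG * Nat.card F * (F.relIndex L * annG.relIndex L')
        = (Nat.card annG * annG.relIndex L') * (Nat.card F * F.relIndex L) := by ring
      _ = Nat.card (L' ⊔ annG : AddSubgroup Y) * Nat.card (L ⊔ F : AddSubgroup X) := by
          rw [hJ, hI]
      _ = Nat.card Y := h1
      _ = Nat.card annG * Nat.card G := h2.symm
      _ = Nat.card annG * (Nat.card F * F.relIndex G) := by rw [hG]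
      _ = Nat.card annG * Nat.card F * F.relIndex G := by ring
  exact Nat.eq_of_mul_eq_mul_left (Nat.mul_pos Nat.card_pos Nat.card_pos) key

end CountingAlgebra

end Summit.BirchSwinnertonDyer.Rank1Residual.JET.GlobalDuality

end
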